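import Literature.MathematicalPhysics.QuantumLattice.StrongExpDecayCentreSymmetry
import Literature.MathematicalPhysics.QuantumLattice.CentreSymmetryConfinementProofs
import HarnessLib

/-!
# Exponential decay of correlations under arbitrary boundary conditions implies confinement
# (Chatterjee, CMP 385 (2021), Thm. 2.4 via Thm. 2.2)

S. Chatterjee, *A probabilistic mechanism for quark confinement*, CMP **385** (2021) [Chatterjee2021]: Theorem 2.4 («if [the
theory] satisfies exponential decay of correlations under arbitrary boundary conditions, according to Definition 2.3, then
it has unbroken center symmetry. Moreover … any Gibbs measure for the theory satisfies Wilson's area law») is proved by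
composing its first assertion with Theorem 2.2 («unbroken center symmetry implies confinement», `|⟨W_ℓ⟩| ≤ e^{−V(R)T}`,
`V(R) → ∞`) and then upgrading `V` to linear growth (§12). The tree now holds both ingredients of the composition as
theorems — the first assertion of Thm. 2.4 for every compact gauge group (`centreUnbroken_of_hasStrongExpDecayZd`,
`StrongExpDecayCentreSymmetry.lean`) and Thm. 2.2 (`chatterjee2021_confinement_of_centreUnbroken_holds`,
`CentreSymmetryConfinementProofs.lean`) — and this file records the composite:

* `confinement_of_hasStrongExpDecayZd` — **Def. 2.3 ⇒ confinement**: in the setting of Thm. 2.2 (`d ≥ 2`, compact connected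
  metrisable `G` with a faithful continuous unitary `ρ`), `HasStrongExpDecayZd d ρ β` gives a function `V → ∞` with
  `‖⟨W_{R×T}⟩_μ‖ ≤ e^{−V(R) T}` for every DLR state `μ`, every rectangular loop with `1 ≤ R ≤ T`, and every irreducible
  unitary `π` acting non-trivially on the centre.

This is the printed Thm. 2.4 WITHOUT the area-law upgrade of §12 (Lemma 12.1 ff.), which stays the named fact
`chatterjee2021_areaLaw_of_strongExpDecay`. The hypotheses `ConnectedSpace G`, `Injective ρ` are those of the vendored
Thm. 2.2 (not used by the centre half).

## References
* S. Chatterjee, CMP 385 (2021) 1007–1039, arXiv:2006.16229: Thm. 2.2, Thm. 2.4, §12.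
-/

noncomputable section

open MeasureTheory Filter
open Literature.Probability.LatticeModels

namespace Literature.MathematicalPhysics.QuantumLattice

/-- ★ **Chatterjee 2021, Theorem 2.4 via Theorem 2.2: exponential decay of correlations under arbitrary boundary
conditions implies confinement.** For `d ≥ 2`, a compact connected metrisable group `G` with a faithful continuous unitary
`ρ : G →* M_N(ℂ)`, and `β` with `HasStrongExpDecayZd d ρ β` (Def. 2.3): for every irreducible continuous unitary `π`
acting non-trivially on the centre there is `V : ℕ → ℝ` with `V(R) → ∞` such that
`‖∫ tr π(hol_{R×T}) dμ‖ ≤ e^{−V(R) T}` for every DLR state `μ ∈ ymGibbsMeasures ρ β`, every base point and plane, and all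
`1 ≤ R ≤ T` (`centreUnbroken_of_hasStrongExpDecayZd` + `chatterjee2021_confinement_of_centreUnbroken_holds`).
[cite: Chatterjee2021, Thm. 2.4 (with Thm. 2.2)] -/
theorem confinement_of_hasStrongExpDecayZd (d : ℕ) [NeZero d] (hd : 2 ≤ d)
    (G : Type) [Group G] [TopologicalSpace G] [IsTopologicalGroup G] [CompactSpace G] [T2Space G]
    [SecondCountableTopology G] [ConnectedSpace G] [MeasurableSpace G] [BorelSpace G]
    (N : ℕ) (ρ : G →* Matrix (Fin N) (Fin N) ℂ) (hρ : Continuous ρ) (hρinj : Function.Injective ρ)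
    (hρu : ∀ g, ρ g ∈ Matrix.unitaryGroup (Fin N) ℂ) (β : ℝ) (hdecay : HasStrongExpDecayZd d ρ β)
    (m : ℕ) (π : G →* Matrix (Fin m) (Fin m) ℂ) (hπ : Continuous π) (hπu : ∀ g, π g ∈ Matrix.unitaryGroup (Fin m) ℂ)
    (hirr : Literature.Analysis.Convex.SymmetryAdapted.IsIrrep π) (hg₀ : ∃ g₀ ∈ Subgroup.center G, π g₀ ≠ 1) :
    ∃ V : ℕ → ℝ, Tendsto V atTop atTop ∧
      ∀ μ ∈ ymGibbsMeasures ρ β,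
        ∀ (x : Site d) (i j : Fin d), i ≠ j → ∀ (R T : ℕ), 1 ≤ R → R ≤ T →
          ‖∫ U, (π (walkHolonomy U (rectWalk x i j R T))).trace ∂μ‖ ≤ Real.exp (-(V R * T)) :=
  chatterjee2021_confinement_of_centreUnbroken_holds d hd G N ρ hρ hρinj hρu β
    (centreUnbroken_of_hasStrongExpDecayZd ρ hρ hdecay) m π hπ hπu hirr hg₀

end Literature.MathematicalPhysics.QuantumLattice

end
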